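import Literature.NumberTheory.Automorphic.UnitaryGroupOrbitalEulerProductRescaled
import HarnessLib

/-!
# The orbital measure BUILT FROM LOCAL ONES through a restricted-product model — Euler product with `c = 1`
(Gelbart (1975) (9.14), p. 155 (10.19); Rogawski (1990) §5.4 p. 72: `Φ(γ, ⊗ f_v) = ∏_v Φ(γ_v, f_v)` with `dg = ⊗_v dg_v`)

Topic `NumberTheory/Automorphic`; namespace `Literature.NumberTheory.Automorphic`. Definitions (with bodies) and theorems; no
instance, no named fact, no `sorry`.  ★ `OrbitalEulerProductModel` ∕ `UnitaryGroupOrbitalEulerProduct[Rescaled]` factorise orbital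
integrals against an ARBITRARY invariant orbital measure with ONE constant `c ≠ 0` (uniqueness); to key a trace formula to local
transfer relations one wants `c = 1` BY CONSTRUCTION: this file DEFINES the global orbital measure from the local ones and proves the
EXACT Euler product.  Setting of ★ `OrbitalEulerProductModel` §2: `e : G_f ≃ₜ* ∏'_i (G_i : K_i)` (compact open `K_i`), local models
`ψ_i : G_i ≃ₜ* L_i`, `γ ∈ G_f`, `γloc i = ψ_i((e γ)_i)`, local orbital measures `m_i` on `L_i ⧸ C(γloc i)` (Borel).

* `orbitalModelSubgroup K ψ i = ψ_i(K_i)`; `orbitalRescaledLocal … i = (m_i(π ψ_i K_i))⁻¹ • m_i`; **`orbitalMeasureOfLocal K ψ e γ γloc hγloc m S₀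
  : Measure (G_f ⧸ C(γ))`** = push the `m_i` THEMSELVES to `G_i ⧸ C((e γ)_i)` along `cosetCongr ψ_i⁻¹`, take the restricted product
  `∏'_i (· ; π_i K_i)` (★ `rpMeasure`; exceptional finite set `S₀` off which the `m_i` give mass `1` to `π(ψ_i K_i)` — the normalisation
  `vol(K_v) = vol(T(𝒪_v)) = 1` for a.a. `v` of [Rogawski1990, §4.3 p. 44]), read it on `(∏' G_i) ⧸ C(e γ)` through ★ `quotientHomeomorph`, push
  forward along `cosetCongr e⁻¹` (definitions with bodies; intermediate Borel σ-algebras fixed inside);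
* `orbitalMeasureOfLocal_spec` and its projections `smulInvariantMeasure_∕isFiniteMeasureOnCompacts_orbitalMeasureOfLocal`,
  `orbitalMeasureOfLocal_ne_zero` (ADMISSIBLE when the `m_i` are invariant, finite on compacta, normalised off `S₀`, `≠ 0` on `S₀`),
  `orbitalMeasureOfLocal_eq_of_subset` (independence of `S₀`), **`orbitalIntegral_orbitalMeasureOfLocal_eq_prod`**: for a scalar pure tensor `F`
  (`F b = ∏_{i∈S} f_i(ψ_i (e b)_i)` on the cylinders from `S₁ ⊇ S₀ ∪ S_γ` on) with integrable orbital integrand,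
  `∀ S₂, (∀ i ∉ S₂, orbitalIntegral (γloc i) (f i) (m i) = 1) → orbitalIntegral γ F (orbitalMeasureOfLocal … m S₀) = ∏_{i∈S₂} orbitalIntegral (γloc i) (f i) (m i)`
  — NO constant, the `m_i` themselves; `tendsto_prod_orbitalIntegral_orbitalMeasureOfLocal` (the partial products converge to it);
* `orbitalMeasureOfLocal_rescaled_spec` — hypothesis-free inhabitant: ALL places rescaled (`S₀ = ∅`), normalised Euler factors.

The `U(H)(𝔸)` dress is the sequel `UnitaryGroupOrbitalMeasureOfLocal`.  Cell `pub/hodgecm-mathlib`, ENGINE T1, O13c-Q4 («ofLocal»).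

## References
* S. Gelbart, *Automorphic forms on adele groups*, Ann. of Math. Stud. 83 (1975), (9.13)–(9.14), p. 155 (10.19) [Gelbart1975].
* J. D. Rogawski, *Automorphic Representations of Unitary Groups in Three Variables* (1990), §4.3 p. 44, §5.4 p. 72 [Rogawski1990].
* J. W. S. Cassels, A. Fröhlich (eds.), *Algebraic Number Theory* (1967), Ch. XV (Tate) §3.3 [CasselsFrohlichANT1967].
-/

noncomputable section

open MeasureTheory Measure Set Filter Topology
open Literature.MeasureTheory.Group Literature.MeasureTheory.RestrictedProduct Literature.Topology.RestrictedProduct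
open scoped ENNReal NNReal RestrictedProduct

namespace Literature.NumberTheory.Automorphic

section Generic

variable {ι : Type} [Countable ι] {G : ι → Type} [∀ i, Group (G i)] [∀ i, TopologicalSpace (G i)]
  [∀ i, IsTopologicalGroup (G i)] [∀ i, SecondCountableTopology (G i)] [∀ i, LocallyCompactSpace (G i)]
  (K : ∀ i, Subgroup (G i)) [hKo : Fact (∀ i, IsOpen (K i : Set (G i)))]
  {Lc : ι → Type} [∀ i, Group (Lc i)] [∀ i, TopologicalSpace (Lc i)] (ψ : ∀ i, G i ≃ₜ* Lc i)
  {Gf : Type} [Group Gf] [TopologicalSpace Gf] [IsTopologicalGroup Gf]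
  (e : Gf ≃ₜ* (Πʳ i, [G i, K i])) (γ : Gf) (γloc : ∀ i, Lc i) (hγloc : ∀ i, ψ i (e γ i) = γloc i)
  [MeasurableSpace (Gf ⧸ Subgroup.centralizer ({γ} : Set Gf))] [BorelSpace (Gf ⧸ Subgroup.centralizer ({γ} : Set Gf))]
  [∀ i, MeasurableSpace (Lc i ⧸ Subgroup.centralizer ({γloc i} : Set (Lc i)))]
  [∀ i, BorelSpace (Lc i ⧸ Subgroup.centralizer ({γloc i} : Set (Lc i)))]
  (m : ∀ i, Measure (Lc i ⧸ Subgroup.centralizer ({γloc i} : Set (Lc i))))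

/-! ### The model subgroups `ψ_i(K_i) ≤ L_i` and the rescaled local measures -/

/-- `ψ_i(K_i) ≤ L_i`, written as the preimage of `K_i` under `ψ_i⁻¹`. [cite: Gelbart1975, (9.13)] -/
def orbitalModelSubgroup (i : ι) : Subgroup (Lc i) := (K i).comap (ψ i).symm.toMulEquiv.toMonoidHom

omit [Countable ι] [∀ i, IsTopologicalGroup (G i)] [∀ i, SecondCountableTopology (G i)] [∀ i, LocallyCompactSpace (G i)] in
/-- `ψ_i(K_i)` is open. [cite: Gelbart1975, (9.13)] -/
theorem isOpen_orbitalModelSubgroup (i : ι) : IsOpen (orbitalModelSubgroup K ψ i : Set (Lc i)) :=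
  (hKo.out i).preimage (ψ i).symm.continuous

/-- **The rescaled local orbital measure** `(m_i(π ψ_i K_i))⁻¹ • m_i` on `L_i ⧸ C(γloc i)` (normalised to mass `1` on the image of
the compact open `ψ_i(K_i)`). [cite: Rogawski1990, §5.4 p. 72] -/
def orbitalRescaledLocal (i : ι) : Measure (Lc i ⧸ Subgroup.centralizer ({γloc i} : Set (Lc i))) :=
  (m i ((QuotientGroup.mk : Lc i → _) '' (orbitalModelSubgroup K ψ i : Set (Lc i))))⁻¹ • m i

omit [Countable ι] [∀ i, IsTopologicalGroup (G i)] [∀ i, SecondCountableTopology (G i)] [∀ i, LocallyCompactSpace (G i)] hKo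
  [∀ i, BorelSpace (Lc i ⧸ Subgroup.centralizer ({γloc i} : Set (Lc i)))] in
/-- Orbital integrals against the rescaled measure. [cite: Rogawski1990, §5.4 p. 72] -/
theorem orbitalIntegral_orbitalRescaledLocal {E : Type*} [NormedAddCommGroup E] [NormedSpace ℝ E] (i : ι) (f : Lc i → E) :
    orbitalIntegral (γloc i) f (orbitalRescaledLocal K ψ γloc m i) =
      ((m i ((QuotientGroup.mk : Lc i → _) '' (orbitalModelSubgroup K ψ i : Set (Lc i))))⁻¹).toReal •
        orbitalIntegral (γloc i) f (m i) :=
  orbitalIntegral_smul_measure _ _ _ _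

/-! ### The global measure -/

omit [Countable ι] [∀ i, IsTopologicalGroup (G i)] [∀ i, SecondCountableTopology (G i)] [∀ i, LocallyCompactSpace (G i)] hKo
  [IsTopologicalGroup Gf]
  [MeasurableSpace (Gf ⧸ Subgroup.centralizer ({γ} : Set Gf))] [BorelSpace (Gf ⧸ Subgroup.centralizer ({γ} : Set Gf))]
  [∀ i, MeasurableSpace (Lc i ⧸ Subgroup.centralizer ({γloc i} : Set (Lc i)))]
  [∀ i, BorelSpace (Lc i ⧸ Subgroup.centralizer ({γloc i} : Set (Lc i)))] in
include hγloc in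
/-- `ψ_i⁻¹ (γloc i) = (e γ)_i` — the compatibility hypothesis of `cosetCongr ψ_i⁻¹`. [cite: Gelbart1975, (9.13)] -/
theorem orbitalModelPoint_eq (i : ι) : (ψ i).symm.toMulEquiv (γloc i) = e γ i := by
  rw [← hγloc i]
  exact (ψ i).symm_apply_apply (e γ i)

/-- **The orbital measure on `G_f ⧸ C(γ)` BUILT FROM THE LOCAL ONES** (exceptional finite set `S₀`, off which the `m_i` are meant to give
mass `1` to `π(ψ_i K_i)`): transport `m_i` to `G_i ⧸ C((e γ)_i)` along `ψ_i⁻¹`, take the restricted product `∏'_i (· ; π_i K_i)` (★ `rpMeasure`),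
read it on `(∏' G_i) ⧸ C(e γ)` through ★ `quotientHomeomorph`, push forward along `cosetCongr e⁻¹`; intermediate Borel σ-algebras are fixed
in the body.  No rescaling: the Euler factors are the orbital integrals against the `m_i` THEMSELVES. [cite: Rogawski1990, §5.4 p. 72] -/
def orbitalMeasureOfLocal (S₀ : Finset ι) : Measure (Gf ⧸ Subgroup.centralizer ({γ} : Set Gf)) :=
  letI : ∀ i, MeasurableSpace (G i ⧸ Subgroup.centralizer ({e γ i} : Set (G i))) := fun _ => borel _
  letI : MeasurableSpace ((Πʳ i, [G i, K i]) ⧸ Subgroup.centralizer ({e γ} : Set (Πʳ i, [G i, K i]))) := borel _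
  ((rpMeasure (fun i => quotBase K (fun i => Subgroup.centralizer ({e γ i} : Set (G i))) i)
      (fun i => (m i).map
        (cosetCongr (ψ i).symm.toMulEquiv _ (Subgroup.centralizer ({e γ i} : Set (G i)))
          (forall_apply_mem_centralizer_singleton_iff_of_eq (ψ i).symm.toMulEquiv
            (orbitalModelPoint_eq K ψ e γ γloc hγloc i))))
      S₀).map
    (quotientHomeomorph K (fun i => Subgroup.centralizer ({e γ i} : Set (G i)))
      (Subgroup.centralizer ({e γ} : Set (Πʳ i, [G i, K i]))) (mem_centralizer_singleton_iff_forall_mem K (e γ)) hKo.out).symm).map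
    (cosetCongr e.symm.toMulEquiv _ (Subgroup.centralizer ({γ} : Set Gf))
      (forall_apply_mem_centralizer_singleton_iff_of_eq e.symm.toMulEquiv (e.symm_apply_apply γ)))

variable [∀ i, SMulInvariantMeasure (Lc i) (Lc i ⧸ Subgroup.centralizer ({γloc i} : Set (Lc i))) (m i)]
  [∀ i, IsFiniteMeasureOnCompacts (m i)]

/-- **Admissibility and the exact Euler products of `orbitalMeasureOfLocal`.** For invariant local orbital measures `m_i` finite on compacta,
of mass `1` on `π(ψ_i K_i)` off `S₀` and non-zero on `S₀`: `μ = orbitalMeasureOfLocal … m S₀` is invariant, finite on compacta and non-zero, AND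
for every scalar pure tensor `F` (`F b = ∏_{i∈S} f_i(ψ_i (e b)_i)` on the cylinders `(e b)_i ∈ K_i`, `i ∉ S`, for all `S ⊇ S₁ ⊇ S₀ ∪ S_γ`) with
`μ`-integrable orbital integrand: the partial products of the `orbitalIntegral (γloc i) (f i) (m i)` converge to `orbitalIntegral γ F μ` ITSELF,
and if they are `1` off a finite `S₂` then `orbitalIntegral γ F μ = ∏_{i∈S₂} orbitalIntegral (γloc i) (f i) (m i)` — NO constant.
[cite: Gelbart1975, p. 155 (10.19)] [cite: Rogawski1990, §5.4 p. 72] -/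
theorem orbitalMeasureOfLocal_spec {S₀ : Finset ι}
    (hm1 : ∀ i, i ∉ S₀ → m i ((QuotientGroup.mk : Lc i → _) '' (⇑(ψ i).symm ⁻¹' (K i : Set (G i)))) = 1)
    (hm : ∀ i, i ∈ S₀ → m i ≠ 0) :
    SMulInvariantMeasure Gf (Gf ⧸ Subgroup.centralizer ({γ} : Set Gf)) (orbitalMeasureOfLocal K ψ e γ γloc hγloc m S₀) ∧
      IsFiniteMeasureOnCompacts (orbitalMeasureOfLocal K ψ e γ γloc hγloc m S₀) ∧
      orbitalMeasureOfLocal K ψ e γ γloc hγloc m S₀ ≠ 0 ∧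
      (∀ S₀' : Finset ι, S₀ ⊆ S₀' → orbitalMeasureOfLocal K ψ e γ γloc hγloc m S₀' = orbitalMeasureOfLocal K ψ e γ γloc hγloc m S₀) ∧
      ∀ (f : ∀ i, Lc i → ℂ) (F : Gf → ℂ) (S₁ : Finset ι),
        (∀ S : Finset ι, S₁ ⊆ S → ∀ b : Gf, (∀ i, i ∉ S → e b i ∈ K i) → F b = ∏ i ∈ S, f i (ψ i (e b i))) →
        (∀ i, i ∉ S₁ → e γ i ∈ K i) → S₀ ⊆ S₁ →
        Integrable (descConj γ (Subgroup.centralizer ({γ} : Set Gf)) (centralizer_comm γ) F)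
          (orbitalMeasureOfLocal K ψ e γ γloc hγloc m S₀) →
          Tendsto (fun T : Finset ι => ∏ i ∈ T, orbitalIntegral (γloc i) (f i) (m i)) atTop
              (𝓝 (orbitalIntegral γ F (orbitalMeasureOfLocal K ψ e γ γloc hγloc m S₀))) ∧
            ∀ S₂ : Finset ι, (∀ i, i ∉ S₂ → orbitalIntegral (γloc i) (f i) (m i) = 1) →
              orbitalIntegral γ F (orbitalMeasureOfLocal K ψ e γ γloc hγloc m S₀) =
                ∏ i ∈ S₂, orbitalIntegral (γloc i) (f i) (m i) := by
  classical
  -- Borel structures on the model orbit spaces (as inside the definition)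
  letI : ∀ i, MeasurableSpace (G i ⧸ Subgroup.centralizer ({e γ i} : Set (G i))) := fun _ => borel _
  haveI : ∀ i, BorelSpace (G i ⧸ Subgroup.centralizer ({e γ i} : Set (G i))) := fun _ => ⟨rfl⟩
  letI : MeasurableSpace ((Πʳ i, [G i, K i]) ⧸ Subgroup.centralizer ({e γ} : Set (Πʳ i, [G i, K i]))) := borel _
  haveI : BorelSpace ((Πʳ i, [G i, K i]) ⧸ Subgroup.centralizer ({e γ} : Set (Πʳ i, [G i, K i]))) := ⟨rfl⟩
  have hγv : ∀ i, (ψ i).symm.toMulEquiv (γloc i) = e γ i := orbitalModelPoint_eq K ψ e γ γloc hγloc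
  have hγ' : e.symm.toMulEquiv (e γ) = γ := e.symm_apply_apply γ
  -- the transported local measures
  let m' : ∀ i, Measure (G i ⧸ Subgroup.centralizer ({e γ i} : Set (G i))) := fun i =>
    (m i).map (cosetCongr (ψ i).symm.toMulEquiv _
      (Subgroup.centralizer ({e γ i} : Set (G i))) (forall_apply_mem_centralizer_singleton_iff_of_eq _ (hγv i)))
  haveI : ∀ i, SMulInvariantMeasure (G i) (G i ⧸ Subgroup.centralizer ({e γ i} : Set (G i))) (m' i) :=
    fun i => smulInvariantMeasure_map_cosetCongr_of_smulInvariant (ψ i).symm.toMulEquiv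
      (ψ i).symm.continuous _ (Subgroup.centralizer ({e γ i} : Set (G i)))
      (forall_apply_mem_centralizer_singleton_iff_of_eq _ (hγv i)) _
  haveI : ∀ i, IsFiniteMeasureOnCompacts (m' i) := fun i =>
    isFiniteMeasureOnCompacts_map_cosetCongr (ψ i).symm.toMulEquiv (ψ i).symm.continuous
      (ψ i).continuous (hγv i) _
  haveI : ∀ i, SigmaFinite (m' i) := fun i => by
    haveI : IsLocallyFiniteMeasure (m' i) := isLocallyFiniteMeasure_of_isFiniteMeasureOnCompacts
    exact sigmaFinite_of_locallyFinite
  have hm1' : ∀ i, i ∉ S₀ →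
      m' i (quotBase K (fun i => Subgroup.centralizer ({e γ i} : Set (G i))) i) = 1 := by
    intro i hi
    change (m i).map _ ((QuotientGroup.mk : G i → _) '' (K i : Set (G i))) = 1
    rw [map_cosetCongr_apply_image_mk (ψ i).symm.toMulEquiv (ψ i).symm.continuous (ψ i).continuous (hγv i)]
    exact hm1 i hi
  have hm'0 : ∀ i, i ∈ S₀ → m' i ≠ 0 := fun i hi =>
    map_cosetCongr_ne_zero (ψ i).symm.toMulEquiv (ψ i).symm.continuous (hγv i) _ (hm i hi)
  -- the product measure on `(∏' G_i) ⧸ C(e γ)` and its three properties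
  haveI hQinv := smulInvariantMeasure_map_quotientHomeomorph_symm K (fun i => Subgroup.centralizer ({e γ i} : Set (G i)))
    (Subgroup.centralizer ({e γ} : Set (Πʳ i, [G i, K i]))) (mem_centralizer_singleton_iff_forall_mem K (e γ)) m' S₀ hm1'
  haveI hQfin := isFiniteMeasureOnCompacts_map_quotientHomeomorph_symm K
    (fun i => Subgroup.centralizer ({e γ i} : Set (G i))) (Subgroup.centralizer ({e γ} : Set (Πʳ i, [G i, K i])))
    (mem_centralizer_singleton_iff_forall_mem K (e γ)) m' S₀ hm1'
  -- unfold the definition into `μQ.map (cosetCongr e⁻¹)`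
  have hdef : orbitalMeasureOfLocal K ψ e γ γloc hγloc m S₀ =
      ((rpMeasure (fun i => quotBase K (fun i => Subgroup.centralizer ({e γ i} : Set (G i))) i) m' S₀).map
        (quotientHomeomorph K (fun i => Subgroup.centralizer ({e γ i} : Set (G i)))
          (Subgroup.centralizer ({e γ} : Set (Πʳ i, [G i, K i]))) (mem_centralizer_singleton_iff_forall_mem K (e γ))
          hKo.out).symm).map
        (cosetCongr e.symm.toMulEquiv _ (Subgroup.centralizer ({γ} : Set Gf))
          (forall_apply_mem_centralizer_singleton_iff_of_eq e.symm.toMulEquiv hγ')) := rfl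
  refine ⟨?_, ?_, ?_, fun S₀' hS₀' => ?_, fun f F S₁ hF hγS hS hFi => ?_⟩
  · rw [hdef]
    exact smulInvariantMeasure_map_cosetCongr_of_smulInvariant e.symm.toMulEquiv e.symm.continuous _ _ _ _
  pick_goal 3
  · have hdef' : orbitalMeasureOfLocal K ψ e γ γloc hγloc m S₀' =
        ((rpMeasure (fun i => quotBase K (fun i => Subgroup.centralizer ({e γ i} : Set (G i))) i) m' S₀').map
          (quotientHomeomorph K (fun i => Subgroup.centralizer ({e γ i} : Set (G i)))
            (Subgroup.centralizer ({e γ} : Set (Πʳ i, [G i, K i]))) (mem_centralizer_singleton_iff_forall_mem K (e γ))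
            hKo.out).symm).map
          (cosetCongr e.symm.toMulEquiv _ (Subgroup.centralizer ({γ} : Set Gf))
            (forall_apply_mem_centralizer_singleton_iff_of_eq e.symm.toMulEquiv hγ')) := rfl
    rw [hdef', hdef, rpMeasure_eq_of_subset (fun i => quotBase K (fun i => Subgroup.centralizer ({e γ i} : Set (G i))) i) m'
      (quotBase_nonempty K _) (measurableSet_quotBase K _) hS₀' hm1']
  · rw [hdef]
    exact isFiniteMeasureOnCompacts_map_cosetCongr e.symm.toMulEquiv e.symm.continuous e.continuous hγ' _
  · rw [hdef]
    exact map_cosetCongr_ne_zero e.symm.toMulEquiv e.symm.continuous hγ' _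
      (map_quotientHomeomorph_symm_ne_zero K (fun i => Subgroup.centralizer ({e γ i} : Set (G i)))
        (Subgroup.centralizer ({e γ} : Set (Πʳ i, [G i, K i]))) (mem_centralizer_singleton_iff_forall_mem K (e γ))
        m' S₀ hm1' hm'0)
  -- the Euler products, read through `cosetCongr e⁻¹` (exact change of variables) and the restricted product (Tate)
  have hrp := rpMeasure_eq_of_subset (fun i => quotBase K (fun i => Subgroup.centralizer ({e γ i} : Set (G i))) i) m'
    (quotBase_nonempty K _) (measurableSet_quotBase K _) hS hm1'
  have hm1'' : ∀ i, i ∉ S₁ → m' i (quotBase K (fun i => Subgroup.centralizer ({e γ i} : Set (G i))) i) = 1 :=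
    fun i hi => hm1' i fun h => hi (hS h)
  have hF' : ∀ S : Finset ι, S₁ ⊆ S → ∀ x : Πʳ i, [G i, K i], (∀ i, i ∉ S → x i ∈ (K i : Set (G i))) →
      (F ∘ ⇑e.symm.toMulEquiv) x = ∏ i ∈ S, (f i ∘ ψ i) (x i) := by
    intro S hS' x hx
    have hx' : ∀ i, i ∉ S → e (e.symm x) i ∈ K i := fun i hi => by
      rw [ContinuousMulEquiv.apply_symm_apply]; exact hx i hi
    show F (e.symm x) = _
    rw [hF S hS' _ hx']
    refine Finset.prod_congr rfl fun i _ => ?_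
    rw [Function.comp_apply, ContinuousMulEquiv.apply_symm_apply]
  -- global change of variables
  have hglob : orbitalIntegral γ F (orbitalMeasureOfLocal K ψ e γ γloc hγloc m S₀) =
      ∫ y, descConj (e γ) (Subgroup.centralizer ({e γ} : Set (Πʳ i, [G i, K i]))) (centralizer_comm (e γ))
        (F ∘ ⇑e.symm.toMulEquiv) y ∂((rpMeasure (fun i => quotBase K (fun i => Subgroup.centralizer ({e γ i} : Set (G i))) i)
          m' S₁).map (quotientHomeomorph K (fun i => Subgroup.centralizer ({e γ i} : Set (G i)))
          (Subgroup.centralizer ({e γ} : Set (Πʳ i, [G i, K i]))) (mem_centralizer_singleton_iff_forall_mem K (e γ))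
          hKo.out).symm) := by
    rw [orbitalIntegral_eq_integral_descConj, hdef, ← hrp]
    exact integral_descConj_map_cosetCongr e.symm.toMulEquiv e.symm.continuous e.continuous hγ' _ F
  have hFi' : Integrable (descConj (e γ) (Subgroup.centralizer ({e γ} : Set (Πʳ i, [G i, K i]))) (centralizer_comm (e γ))
      (F ∘ ⇑e.symm.toMulEquiv)) ((rpMeasure (fun i => quotBase K (fun i => Subgroup.centralizer ({e γ i} : Set (G i))) i)
          m' S₁).map (quotientHomeomorph K (fun i => Subgroup.centralizer ({e γ i} : Set (G i)))
          (Subgroup.centralizer ({e γ} : Set (Πʳ i, [G i, K i]))) (mem_centralizer_singleton_iff_forall_mem K (e γ))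
          hKo.out).symm) := by
    rw [← hrp, ← integrable_descConj_map_cosetCongr_iff e.symm.toMulEquiv e.symm.continuous e.continuous hγ', ← hdef]
    exact hFi
  -- local change of variables
  have hloc : ∀ i, ∫ y, descConj (e γ i) (Subgroup.centralizer ({e γ i} : Set (G i))) (centralizer_comm (e γ i))
      (f i ∘ ψ i) y ∂(m' i) = orbitalIntegral (γloc i) (f i) (m i) := by
    intro i
    change ∫ y, _ ∂(m i).map _ = _
    rw [integral_descConj_map_cosetCongr (ψ i).symm.toMulEquiv (ψ i).symm.continuous (ψ i).continuous (hγv i)]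
    have hcomp : (f i ∘ ψ i) ∘ ⇑(ψ i).symm.toMulEquiv = f i := funext fun y => by
      show f i (ψ i ((ψ i).symm y)) = f i y
      rw [ContinuousMulEquiv.apply_symm_apply]
    rw [hcomp]
    rfl
  refine ⟨?_, fun S₂ hf1 => ?_⟩
  · have h := tendsto_prod_integral_map_quotientHomeomorph_symm K (fun i => Subgroup.centralizer ({e γ i} : Set (G i)))
      (Subgroup.centralizer ({e γ} : Set (Πʳ i, [G i, K i]))) (mem_centralizer_singleton_iff_forall_mem K (e γ)) m' S₁
      hm1'' (fun i => descConj (e γ i) (Subgroup.centralizer ({e γ i} : Set (G i))) (centralizer_comm (e γ i)) (f i ∘ ψ i))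
      _ (forall_descConj_mk_eq_prod K (e γ) (fun i => f i ∘ ψ i) _ hF' hγS) hFi'
    rw [← hglob] at h
    have hfun : (fun T : Finset ι => ∏ i ∈ T, ∫ y, descConj (e γ i) (Subgroup.centralizer ({e γ i} : Set (G i)))
        (centralizer_comm (e γ i)) (f i ∘ ψ i) y ∂(m' i)) =
        fun T : Finset ι => ∏ i ∈ T, orbitalIntegral (γloc i) (f i) (m i) :=
      funext fun T => Finset.prod_congr rfl fun i _ => hloc i
    rw [hfun] at h
    exact h
  · rw [hglob]
    rw [integral_map_quotientHomeomorph_symm_eq_prod K (fun i => Subgroup.centralizer ({e γ i} : Set (G i)))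
      (Subgroup.centralizer ({e γ} : Set (Πʳ i, [G i, K i]))) (mem_centralizer_singleton_iff_forall_mem K (e γ)) m' S₁
      hm1'' (fun i => descConj (e γ i) (Subgroup.centralizer ({e γ i} : Set (G i))) (centralizer_comm (e γ i)) (f i ∘ ψ i))
      _ (forall_descConj_mk_eq_prod K (e γ) (fun i => f i ∘ ψ i) _ hF' hγS) hFi'
      (fun i hi => by rw [hloc i]; exact hf1 i hi)]
    exact Finset.prod_congr rfl fun i _ => hloc i

/-- `orbitalMeasureOfLocal … m S₀` is invariant (admissible inputs normalised off `S₀`). [cite: Rogawski1990, §5.4 p. 72] -/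
theorem smulInvariantMeasure_orbitalMeasureOfLocal {S₀ : Finset ι}
    (hm1 : ∀ i, i ∉ S₀ → m i ((QuotientGroup.mk : Lc i → _) '' (⇑(ψ i).symm ⁻¹' (K i : Set (G i)))) = 1)
    (hm : ∀ i, i ∈ S₀ → m i ≠ 0) :
    SMulInvariantMeasure Gf (Gf ⧸ Subgroup.centralizer ({γ} : Set Gf)) (orbitalMeasureOfLocal K ψ e γ γloc hγloc m S₀) :=
  (orbitalMeasureOfLocal_spec K ψ e γ γloc hγloc m hm1 hm).1

/-- `orbitalMeasureOfLocal … m S₀` is finite on compacta (admissible inputs normalised off `S₀`). [cite: Rogawski1990, §5.4 p. 72] -/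
theorem isFiniteMeasureOnCompacts_orbitalMeasureOfLocal {S₀ : Finset ι}
    (hm1 : ∀ i, i ∉ S₀ → m i ((QuotientGroup.mk : Lc i → _) '' (⇑(ψ i).symm ⁻¹' (K i : Set (G i)))) = 1)
    (hm : ∀ i, i ∈ S₀ → m i ≠ 0) :
    IsFiniteMeasureOnCompacts (orbitalMeasureOfLocal K ψ e γ γloc hγloc m S₀) :=
  (orbitalMeasureOfLocal_spec K ψ e γ γloc hγloc m hm1 hm).2.1

/-- `orbitalMeasureOfLocal … m S₀ ≠ 0` (admissible inputs normalised off `S₀`, non-zero on `S₀`). [cite: Rogawski1990, §5.4 p. 72] -/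
theorem orbitalMeasureOfLocal_ne_zero {S₀ : Finset ι}
    (hm1 : ∀ i, i ∉ S₀ → m i ((QuotientGroup.mk : Lc i → _) '' (⇑(ψ i).symm ⁻¹' (K i : Set (G i)))) = 1)
    (hm : ∀ i, i ∈ S₀ → m i ≠ 0) : orbitalMeasureOfLocal K ψ e γ γloc hγloc m S₀ ≠ 0 :=
  (orbitalMeasureOfLocal_spec K ψ e γ γloc hγloc m hm1 hm).2.2.1

/-- **Independence of the exceptional set**: for `S₀ ⊆ S₀'` (normalisation off `S₀`) the constructions agree (★ `rpMeasure_eq_of_subset`).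
[cite: CasselsFrohlichANT1967, Ch. XV (Tate) §3.3] -/
theorem orbitalMeasureOfLocal_eq_of_subset {S₀ S₀' : Finset ι} (h : S₀ ⊆ S₀')
    (hm1 : ∀ i, i ∉ S₀ → m i ((QuotientGroup.mk : Lc i → _) '' (⇑(ψ i).symm ⁻¹' (K i : Set (G i)))) = 1)
    (hm : ∀ i, i ∈ S₀ → m i ≠ 0) :
    orbitalMeasureOfLocal K ψ e γ γloc hγloc m S₀' = orbitalMeasureOfLocal K ψ e γ γloc hγloc m S₀ :=
  (orbitalMeasureOfLocal_spec K ψ e γ γloc hγloc m hm1 hm).2.2.2.1 S₀' h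

/-- **Exact Euler product, convergence form**: `∏_{i∈T} orbitalIntegral (γloc i) (f i) (m i) ⟶ orbitalIntegral γ F (orbitalMeasureOfLocal … m S₀)`
— no constant, no unramified computation, no rescaling. [cite: Gelbart1975, p. 155 (10.19)] -/
theorem tendsto_prod_orbitalIntegral_orbitalMeasureOfLocal {S₀ : Finset ι}
    (hm1 : ∀ i, i ∉ S₀ → m i ((QuotientGroup.mk : Lc i → _) '' (⇑(ψ i).symm ⁻¹' (K i : Set (G i)))) = 1)
    (hm : ∀ i, i ∈ S₀ → m i ≠ 0) (f : ∀ i, Lc i → ℂ) (F : Gf → ℂ) (S₁ : Finset ι)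
    (hF : ∀ S : Finset ι, S₁ ⊆ S → ∀ b : Gf, (∀ i, i ∉ S → e b i ∈ K i) → F b = ∏ i ∈ S, f i (ψ i (e b i)))
    (hγS : ∀ i, i ∉ S₁ → e γ i ∈ K i) (hS : S₀ ⊆ S₁)
    (hFi : Integrable (descConj γ (Subgroup.centralizer ({γ} : Set Gf)) (centralizer_comm γ) F)
      (orbitalMeasureOfLocal K ψ e γ γloc hγloc m S₀)) :
    Tendsto (fun T : Finset ι => ∏ i ∈ T, orbitalIntegral (γloc i) (f i) (m i)) atTop
      (𝓝 (orbitalIntegral γ F (orbitalMeasureOfLocal K ψ e γ γloc hγloc m S₀))) :=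
  ((orbitalMeasureOfLocal_spec K ψ e γ γloc hγloc m hm1 hm).2.2.2.2 f F S₁ hF hγS hS hFi).1

/-- **Exact Euler product, stabilised form**: if the local orbital integrals are `1` off a finite `S₂`,
`orbitalIntegral γ F (orbitalMeasureOfLocal … m S₀) = ∏_{i∈S₂} orbitalIntegral (γloc i) (f i) (m i)` — NO constant: Rogawski's
`Φ(γ, f) = ∏_v Φ(γ_v, f_v)` for `dg = ⊗ dg_v`, in W8-shape (a finite product over any `S₂` carrying the non-trivial factors, never a
bare `∏ᶠ`). [cite: Gelbart1975, p. 155 (10.19)] [cite: Rogawski1990, §5.4 p. 72] -/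
theorem orbitalIntegral_orbitalMeasureOfLocal_eq_prod {S₀ : Finset ι}
    (hm1 : ∀ i, i ∉ S₀ → m i ((QuotientGroup.mk : Lc i → _) '' (⇑(ψ i).symm ⁻¹' (K i : Set (G i)))) = 1)
    (hm : ∀ i, i ∈ S₀ → m i ≠ 0) (f : ∀ i, Lc i → ℂ) (F : Gf → ℂ) (S₁ S₂ : Finset ι)
    (hF : ∀ S : Finset ι, S₁ ⊆ S → ∀ b : Gf, (∀ i, i ∉ S → e b i ∈ K i) → F b = ∏ i ∈ S, f i (ψ i (e b i)))
    (hγS : ∀ i, i ∉ S₁ → e γ i ∈ K i) (hS : S₀ ⊆ S₁)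
    (hFi : Integrable (descConj γ (Subgroup.centralizer ({γ} : Set Gf)) (centralizer_comm γ) F)
      (orbitalMeasureOfLocal K ψ e γ γloc hγloc m S₀))
    (hf1 : ∀ i, i ∉ S₂ → orbitalIntegral (γloc i) (f i) (m i) = 1) :
    orbitalIntegral γ F (orbitalMeasureOfLocal K ψ e γ γloc hγloc m S₀) = ∏ i ∈ S₂, orbitalIntegral (γloc i) (f i) (m i) :=
  ((orbitalMeasureOfLocal_spec K ψ e γ γloc hγloc m hm1 hm).2.2.2.2 f F S₁ hF hγS hS hFi).2 S₂ hf1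

/-! ### All places rescaled: a hypothesis-free admissible inhabitant -/

variable [hKc : ∀ i, CompactSpace (K i)] [∀ i, IsTopologicalGroup (Lc i)] [∀ i, SecondCountableTopology (Lc i)]
  [∀ i, LocallyCompactSpace (Lc i)]

omit [Countable ι] [∀ i, IsTopologicalGroup (G i)] [∀ i, SecondCountableTopology (G i)] [∀ i, LocallyCompactSpace (G i)] hKo
  [∀ i, IsTopologicalGroup (Lc i)] [∀ i, SecondCountableTopology (Lc i)] [∀ i, LocallyCompactSpace (Lc i)] in
/-- `ψ_i(K_i)` is compact. [cite: Gelbart1975, (9.13)] -/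
theorem isCompact_orbitalModelSubgroup (i : ι) : IsCompact (orbitalModelSubgroup K ψ i : Set (Lc i)) := by
  have hset : (orbitalModelSubgroup K ψ i : Set (Lc i)) = ⇑(ψ i) '' (K i : Set (G i)) := by
    ext x
    constructor
    · intro hx
      exact ⟨(ψ i).symm x, hx, (ψ i).apply_symm_apply x⟩
    · rintro ⟨k, hk, rfl⟩
      show (ψ i).symm (ψ i k) ∈ K i
      rw [ContinuousMulEquiv.symm_apply_apply]
      exact hk
  rw [hset]
  exact (isCompact_iff_compactSpace.2 (hKc i)).image (ψ i).continuous

omit [Countable ι] [∀ i, IsTopologicalGroup (G i)] [∀ i, SecondCountableTopology (G i)] [∀ i, LocallyCompactSpace (G i)]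
  [∀ i, BorelSpace (Lc i ⧸ Subgroup.centralizer ({γloc i} : Set (Lc i)))] in
/-- The rescaled local measures are admissible and normalised: invariant, finite on compacta, non-zero, mass `1` on
`π(ψ_i K_i)` (for admissible `m_i`). [cite: Rogawski1990, §5.4 p. 72] -/
theorem orbitalRescaledLocal_admissible (hm : ∀ i, m i ≠ 0) (i : ι) :
    SMulInvariantMeasure (Lc i) (Lc i ⧸ Subgroup.centralizer ({γloc i} : Set (Lc i))) (orbitalRescaledLocal K ψ γloc m i) ∧
      IsFiniteMeasureOnCompacts (orbitalRescaledLocal K ψ γloc m i) ∧ orbitalRescaledLocal K ψ γloc m i ≠ 0 ∧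
      orbitalRescaledLocal K ψ γloc m i
        ((QuotientGroup.mk : Lc i → _) '' (⇑(ψ i).symm ⁻¹' (K i : Set (G i)))) = 1 := by
  refine ⟨inferInstanceAs (SMulInvariantMeasure _ _ (_ • m i)), ?_, ?_, ?_⟩
  · exact isFiniteMeasureOnCompacts_inv_smul (γloc i) (m i) (orbitalModelSubgroup K ψ i)
      (measure_image_mk_pos (γloc i) (m i) _ (hm i) (isOpen_orbitalModelSubgroup K ψ i))
  · exact inv_smul_ne_zero (γloc i) (m i) _ (hm i) (isCompact_orbitalModelSubgroup K ψ i)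
  · exact smul_measure_image_mk_eq_one (γloc i) (m i) (orbitalModelSubgroup K ψ i) (hm i)
      (isOpen_orbitalModelSubgroup K ψ i) (isCompact_orbitalModelSubgroup K ψ i)

/-- **The rescaled construction** `orbitalMeasureOfLocal … (orbitalRescaledLocal … m) ∅`: for ANY admissible local family (`m_i ≠ 0`, invariant,
finite on compacta) it is admissible, with Euler factors the NORMALISED `factor_i = (m_i(π ψ_i K_i))⁻¹ · orbitalIntegral (γloc i) (f i) (m i)`:
`∀ S₂, (∀ i ∉ S₂, factor_i = 1) → orbitalIntegral γ F μ = ∏_{i∈S₂} factor_i`. [cite: Gelbart1975, p. 155 (10.19)] [cite: Rogawski1990, §5.4 p. 72] -/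
theorem orbitalMeasureOfLocal_rescaled_spec (hm : ∀ i, m i ≠ 0) :
    SMulInvariantMeasure Gf (Gf ⧸ Subgroup.centralizer ({γ} : Set Gf))
        (orbitalMeasureOfLocal K ψ e γ γloc hγloc (orbitalRescaledLocal K ψ γloc m) ∅) ∧
      IsFiniteMeasureOnCompacts (orbitalMeasureOfLocal K ψ e γ γloc hγloc (orbitalRescaledLocal K ψ γloc m) ∅) ∧
      orbitalMeasureOfLocal K ψ e γ γloc hγloc (orbitalRescaledLocal K ψ γloc m) ∅ ≠ 0 ∧
      ∀ (f : ∀ i, Lc i → ℂ) (F : Gf → ℂ) (S₁ : Finset ι),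
        (∀ S : Finset ι, S₁ ⊆ S → ∀ b : Gf, (∀ i, i ∉ S → e b i ∈ K i) → F b = ∏ i ∈ S, f i (ψ i (e b i))) →
        (∀ i, i ∉ S₁ → e γ i ∈ K i) →
        Integrable (descConj γ (Subgroup.centralizer ({γ} : Set Gf)) (centralizer_comm γ) F)
          (orbitalMeasureOfLocal K ψ e γ γloc hγloc (orbitalRescaledLocal K ψ γloc m) ∅) →
          Tendsto (fun T : Finset ι => ∏ i ∈ T,
              ((m i ((QuotientGroup.mk : Lc i → _) '' (orbitalModelSubgroup K ψ i : Set (Lc i))))⁻¹).toReal •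
                orbitalIntegral (γloc i) (f i) (m i)) atTop
              (𝓝 (orbitalIntegral γ F (orbitalMeasureOfLocal K ψ e γ γloc hγloc (orbitalRescaledLocal K ψ γloc m) ∅))) ∧
            ∀ S₂ : Finset ι, (∀ i, i ∉ S₂ →
              ((m i ((QuotientGroup.mk : Lc i → _) '' (orbitalModelSubgroup K ψ i : Set (Lc i))))⁻¹).toReal •
                orbitalIntegral (γloc i) (f i) (m i) = 1) →
              orbitalIntegral γ F (orbitalMeasureOfLocal K ψ e γ γloc hγloc (orbitalRescaledLocal K ψ γloc m) ∅) =
                ∏ i ∈ S₂, ((m i ((QuotientGroup.mk : Lc i → _) '' (orbitalModelSubgroup K ψ i : Set (Lc i))))⁻¹).toReal •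
                  orbitalIntegral (γloc i) (f i) (m i) := by
  have hresc := orbitalRescaledLocal_admissible K ψ γloc m hm
  haveI : ∀ i, SMulInvariantMeasure (Lc i) _ (orbitalRescaledLocal K ψ γloc m i) := fun i => (hresc i).1
  haveI : ∀ i, IsFiniteMeasureOnCompacts (orbitalRescaledLocal K ψ γloc m i) := fun i => (hresc i).2.1
  have h := orbitalMeasureOfLocal_spec K ψ e γ γloc hγloc (orbitalRescaledLocal K ψ γloc m) (S₀ := ∅)
    (fun i _ => (hresc i).2.2.2) (fun i hi => absurd hi (Finset.notMem_empty i))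
  refine ⟨h.1, h.2.1, h.2.2.1, fun f F S₁ hF hγS hFi => ?_⟩
  have h4 := h.2.2.2.2 f F S₁ hF hγS (Finset.empty_subset _) hFi
  simp only [orbitalIntegral_orbitalRescaledLocal] at h4
  exact h4

end Generic

end Literature.NumberTheory.Automorphic

end
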